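import Literature.NumberTheory.Automorphic.QuasiSplitUnitaryAutomorphicMeasure
import Literature.NumberTheory.Automorphic.UnitaryGroupFiniteCovolume
import Literature.NumberTheory.Automorphic.HermitianOrbitCountSiegelIntegrable
import HarnessLib

/-!
# Crux `H413`, ENGINE T1 line `F0_T1InnerFormTraceIdentity` — stub S3 `stub_T1c_splitFormAutomorphicMeasure`, PART 1:
# the ranks `N ≤ 1` and the reduction of the stub to reduction theory (a covering set of finite volume) for `N ≥ 2`

Cell hodgecm-mathlib, FLOOR 0, crux item H413 = stmt-HodgeConjecture-24833; programme P3a (ENGINE T1 = trace formula for the inner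
form + stabilisation, statement layer), registered line `Cruxes/H413/Lines/F0_T1InnerFormTraceIdentity.lean` (ed. 1.2 0fea4861 ≡ ed. 1.3),
brief B5 of `F0/P3a/BRIEFS-T1-wave2` (seat F0P3a-p04 (g0)).  PROOF lane, theorems only; `--supports stmt-HodgeConjecture-24833`.
Theorems never import `Cruxes/…/Lines`: the stub's statement is repeated BY VALUE (token identity is the referee's cert).

The registered stub S3 is
`StubT1cSplitFormAutomorphicMeasure L := ∀ N : ℕ, ∃ μ' : Measure (UnitaryGroup.cmDatum L N Φ_N).automorphicQuotient,
  (UnitaryGroup.cmDatum L N Φ_N).IsAutomorphicMeasure μ'`, `Φ_N = Matrix.of fun i j : Fin N => if i.val + j.val + 1 = N then (1 : L) else 0`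
(the split anti-diagonal hermitian form; `U(Φ_N)` is the quasi-split unitary group in `N` variables of the CM extension `L/L⁺`).

* §1 `splitFormMatrix_zero`, `splitFormMatrix_one` — `Φ_0`, `Φ_1 = (1)`; `stubS3_at_zero`, `stubS3_at_one` — the stub's conjuncts at
  `N = 0, 1` are ★ (`U(Φ_1) = U(1)` is ANISOTROPIC: compact quotient, ★ `UnitaryGroup.exists_isAutomorphicMeasure_cmDatum_one`).
* §2 `stubS3_of_cover` — **the reduction**: if for every `N ≥ 2` the quasi-split `U(Φ_N)(𝔸_{L⁺})` carries a Borel structure, a Haar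
  measure `ν` and a set `C` of finite `ν`-measure meeting every coset of `U(Φ_N)(L⁺)` (a SIEGEL SET — reduction theory, Borel (1963) §5,
  briefs B6a∕B6b), and the modular function of `U(Φ_N)(𝔸_{L⁺})` is trivial on `U(Φ_N)(L⁺)` (`hmod`), then the stub body holds VERBATIM
  (★ `UnitaryGroup.exists_isAutomorphicMeasure_cmDatum_of_cover`, the `A_G = ⊥` covering-set constructor).  `stubS3_le_three_of_cover` is
  the same for the `N ≤ 3` restatement the planner holds in reserve (ruling 2026-08-30T22:25:29Z), from cover data at `N = 2, 3` only.
* §3 (ed. 2, seat F0P3a-p04, S3 file plan T7) `splitFormMatrix_isHermitian`, `splitFormMatrix_mul_self`, `splitFormMatrix_det_ne_zero` —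
  `Φ_N` is hermitian with `Φ_N² = 1`; **`stubS3_of_orbitCount`** — the registered S3 body (ed. 1.4: `∀ N ≤ 3`) and `stubS3_all_of_orbitCount`
  (every `N`) from the SIEGEL-SET INTEGRABILITY OF THE HERMITIAN ORBIT COUNT on `GL_N(𝔸_L)` (hypothesis `hcount`, the export of the
  counting files `HermitianRationalPointCount` ∕ `SiegelConeCountExponent` ∕ `SiegelSetWeightedVolume` ∕ `HermitianOrbitCountSiegelIntegrable`
  of the S3 plan), through ★ `UnitaryGroup.exists_isAutomorphicMeasure_cmDatum_of_orbitCount` (Borel–Harish-Chandra for `U(H)` by orbit-count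
  unfolding against the tree's reduction theory of `GL_N(𝔸_L)`, files `LatticeCovolumeDescent` ∕ `UnitaryGroupHermitianOrbitCount` ∕
  `UnitaryGroupFiniteCovolume`), and **THE CLOSER `stubS3_holds`** — TYPE = the registered S3 body VERBATIM — obtained by discharging `hcount` with
  ★ `lintegral_ncard_hermitianOrbitSet_siegelSet_lt_top` (`HermitianOrbitCountSiegelIntegrable`, seat F0P3a-p05, over ★ T2–T5 of p02∕p05∕p06); also
  `stubS3_all` — the original `∀ N` body of editions ≤ 1.3, now a THEOREM (automorphic measure on `U(Φ_N)(L⁺)\U(Φ_N)(𝔸_{L⁺})` for every `N`).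

HC_CM is proved only modulo the printed citations until rung 0 closes; this file proves nothing about them.

## References
* [Borel1963] A. Borel, *Some finiteness properties of adele groups over number fields*, Publ. Math. IHÉS 16 (1963), §5, Thm. 5.8.
* [PlatonovRapinchuk1994] V. Platonov, A. Rapinchuk, *Algebraic Groups and Number Theory* (1994), Thm. 4.17, §5.2–5.3.
* Tree: ★ `Literature/NumberTheory/Automorphic/QuasiSplitUnitaryAutomorphicMeasure` (this seat), ★ `AdelicUnitaryGroupMeasure`,
  ★ `AdelicUnitaryGroupDatum` (`UnitaryGroup.cmDatum`).
-/

-- the mandated namespace repeats `HodgeConjecture.HodgeConjecture`, as in every `Theorems/*.lean` of this sub-problem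
set_option linter.dupNamespace false
set_option autoImplicit false

noncomputable section

open MeasureTheory Measure NumberField
open Literature.NumberTheory.Automorphic
open scoped ENNReal MatrixGroups Matrix Pointwise

namespace Summit.HodgeConjecture.HodgeConjecture.Cruxes.H413.F0P3aStubS3SplitFormMeasure

variable (L : Type) [Field L] [NumberField L] [IsCMField L]

/-! ## §1 The ranks `N = 0, 1` -/

omit [NumberField L] [IsCMField L] in
/-- The stub's inlined split form at `N = 1` is the identity matrix `Φ_1 = (1)`. [folklore] -/
theorem splitFormMatrix_one :
    (Matrix.of fun i j : Fin 1 => if i.val + j.val + 1 = 1 then (1 : L) else 0) = 1 := by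
  ext i j
  fin_cases i; fin_cases j
  rfl

omit [NumberField L] [IsCMField L] in
/-- The stub's inlined split form at `N = 0` is the (empty) identity matrix. [folklore] -/
theorem splitFormMatrix_zero :
    (Matrix.of fun i j : Fin 0 => if i.val + j.val + 1 = 0 then (1 : L) else 0) = 1 := by
  ext i
  exact Fin.elim0 i

/-- **S3 at `N = 1`**: `U(Φ_1) = U(1)_{L/L⁺}` is anisotropic (compact automorphic quotient), so its automorphic measure is the tree's
anisotropic constructor (★ `UnitaryGroup.exists_isAutomorphicMeasure_cmDatum_one`). [cite: Borel1963, §5] -/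
theorem stubS3_at_one :
    ∃ μ' : Measure (UnitaryGroup.cmDatum L 1
        (Matrix.of fun i j : Fin 1 => if i.val + j.val + 1 = 1 then (1 : L) else 0)).automorphicQuotient,
      (UnitaryGroup.cmDatum L 1
        (Matrix.of fun i j : Fin 1 => if i.val + j.val + 1 = 1 then (1 : L) else 0)).IsAutomorphicMeasure μ' := by
  rw [splitFormMatrix_one]
  exact UnitaryGroup.exists_isAutomorphicMeasure_cmDatum_one L 1

/-- **S3 at `N = 0`**: the unitary group of the empty form is trivial (★ `UnitaryGroup.exists_isAutomorphicMeasure_cmDatum_zero`).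
[cite: Borel1963, §5] -/
theorem stubS3_at_zero :
    ∃ μ' : Measure (UnitaryGroup.cmDatum L 0
        (Matrix.of fun i j : Fin 0 => if i.val + j.val + 1 = 0 then (1 : L) else 0)).automorphicQuotient,
      (UnitaryGroup.cmDatum L 0
        (Matrix.of fun i j : Fin 0 => if i.val + j.val + 1 = 0 then (1 : L) else 0)).IsAutomorphicMeasure μ' :=
  UnitaryGroup.exists_isAutomorphicMeasure_cmDatum_zero L _

/-! ## §2 The reduction of S3 to a covering set of finite volume (`N ≥ 2`) -/

/-- **Stub S3 from reduction theory.**  Suppose that for every `N ≥ 2` the quasi-split unitary group `U(Φ_N)(𝔸_{L⁺})`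
(`(UnitaryGroup.cmDatum L N Φ_N).Adelic`) is given a Borel structure, a Haar measure `ν` and a set `C` with `ν C < ∞` whose image is the
whole automorphic quotient (a Siegel set: `U(Φ_N)(𝔸) = C · U(Φ_N)(L⁺)`), and that the modular function of `U(Φ_N)(𝔸_{L⁺})` is `1` on the
rational points `U(Φ_N)(L⁺)`.  Then the registered stub `StubT1cSplitFormAutomorphicMeasure L` holds — its body is the conclusion, verbatim:
`N = 0, 1` by §1, `N ≥ 2` by ★ `UnitaryGroup.exists_isAutomorphicMeasure_cmDatum_of_cover` (Borel–Harish-Chandra's construction of the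
finite invariant measure on `G_A/G_K` from a fundamental set of finite Haar measure). [cite: Borel1963, §5] [cite: PlatonovRapinchuk1994, Thm. 4.17] -/
theorem stubS3_of_cover
    (hcover : ∀ N : ℕ, 2 ≤ N →
      ∃ (_ : MeasurableSpace (UnitaryGroup.cmDatum L N
            (Matrix.of fun i j : Fin N => if i.val + j.val + 1 = N then (1 : L) else 0)).Adelic)
        (_ : BorelSpace (UnitaryGroup.cmDatum L N
            (Matrix.of fun i j : Fin N => if i.val + j.val + 1 = N then (1 : L) else 0)).Adelic)
        (ν : Measure (UnitaryGroup.cmDatum L N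
            (Matrix.of fun i j : Fin N => if i.val + j.val + 1 = N then (1 : L) else 0)).Adelic)
        (_ : ν.IsHaarMeasure)
        (C : Set (UnitaryGroup.cmDatum L N
            (Matrix.of fun i j : Fin N => if i.val + j.val + 1 = N then (1 : L) else 0)).Adelic),
        (∀ γ ∈ (UnitaryGroup.cmDatum L N
            (Matrix.of fun i j : Fin N => if i.val + j.val + 1 = N then (1 : L) else 0)).arithmeticSubgroup,
            modularCharacter γ = 1) ∧
        (UnitaryGroup.cmDatum L N
            (Matrix.of fun i j : Fin N => if i.val + j.val + 1 = N then (1 : L) else 0)).toAutomorphicQuotient '' C =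
          Set.univ ∧
        ν C < ∞) :
    ∀ N : ℕ, ∃ μ' : Measure (UnitaryGroup.cmDatum L N
        (Matrix.of fun i j : Fin N => if i.val + j.val + 1 = N then (1 : L) else 0)).automorphicQuotient,
      (UnitaryGroup.cmDatum L N
        (Matrix.of fun i j : Fin N => if i.val + j.val + 1 = N then (1 : L) else 0)).IsAutomorphicMeasure μ' := by
  intro N
  rcases Nat.lt_or_ge N 2 with hN | hN
  · interval_cases N
    · exact stubS3_at_zero L
    · exact stubS3_at_one L
  · obtain ⟨_, _, ν, _, C, hmod, hcov, hfin⟩ := hcover N hN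
    exact UnitaryGroup.exists_isAutomorphicMeasure_cmDatum_of_cover L N _ hmod ν hcov hfin

/-- **The `N ≤ 3` form of S3 from cover data at `N = 2` and `N = 3` only** (for the planner's reserve restatement
`∀ N ≤ 3, ∃ μ', IsAutomorphicMeasure μ'` — ruling 2026-08-30T22:25:29Z: the kit consumes only `N = 3`, the endoscopic `H = U(2) × U(1)` needs
`N = 2, 1`): reduction theory is then needed only in Witt rank `1`. [cite: Borel1963, §5] -/
theorem stubS3_le_three_of_cover
    (hcover : ∀ N : ℕ, 2 ≤ N → N ≤ 3 →
      ∃ (_ : MeasurableSpace (UnitaryGroup.cmDatum L N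
            (Matrix.of fun i j : Fin N => if i.val + j.val + 1 = N then (1 : L) else 0)).Adelic)
        (_ : BorelSpace (UnitaryGroup.cmDatum L N
            (Matrix.of fun i j : Fin N => if i.val + j.val + 1 = N then (1 : L) else 0)).Adelic)
        (ν : Measure (UnitaryGroup.cmDatum L N
            (Matrix.of fun i j : Fin N => if i.val + j.val + 1 = N then (1 : L) else 0)).Adelic)
        (_ : ν.IsHaarMeasure)
        (C : Set (UnitaryGroup.cmDatum L N
            (Matrix.of fun i j : Fin N => if i.val + j.val + 1 = N then (1 : L) else 0)).Adelic),
        (∀ γ ∈ (UnitaryGroup.cmDatum L N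
            (Matrix.of fun i j : Fin N => if i.val + j.val + 1 = N then (1 : L) else 0)).arithmeticSubgroup,
            modularCharacter γ = 1) ∧
        (UnitaryGroup.cmDatum L N
            (Matrix.of fun i j : Fin N => if i.val + j.val + 1 = N then (1 : L) else 0)).toAutomorphicQuotient '' C =
          Set.univ ∧
        ν C < ∞) :
    ∀ N : ℕ, N ≤ 3 → ∃ μ' : Measure (UnitaryGroup.cmDatum L N
        (Matrix.of fun i j : Fin N => if i.val + j.val + 1 = N then (1 : L) else 0)).automorphicQuotient,
      (UnitaryGroup.cmDatum L N
        (Matrix.of fun i j : Fin N => if i.val + j.val + 1 = N then (1 : L) else 0)).IsAutomorphicMeasure μ' := by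
  intro N hN3
  rcases Nat.lt_or_ge N 2 with hN | hN
  · interval_cases N
    · exact stubS3_at_zero L
    · exact stubS3_at_one L
  · obtain ⟨_, _, ν, _, C, hmod, hcov, hfin⟩ := hcover N hN hN3
    exact UnitaryGroup.exists_isAutomorphicMeasure_cmDatum_of_cover L N _ hmod ν hcov hfin

/-! ## §3 The split form is hermitian non-degenerate; S3 from the Siegel-set integrability of the hermitian orbit count -/

omit [NumberField L] [IsCMField L] in
/-- `Φ_N² = 1`: the anti-diagonal permutation matrix is an involution. [folklore] -/
theorem splitFormMatrix_mul_self (N : ℕ) :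
    (Matrix.of fun i j : Fin N => if i.val + j.val + 1 = N then (1 : L) else 0) *
        (Matrix.of fun i j : Fin N => if i.val + j.val + 1 = N then (1 : L) else 0) = 1 := by
  ext i k
  rw [Matrix.mul_apply, Matrix.one_apply, Finset.sum_eq_single (Fin.rev i)]
  · simp only [Matrix.of_apply, Fin.val_rev]
    have hi := i.isLt
    rw [if_pos (by omega), one_mul]
    by_cases hik : i = k
    · subst hik
      rw [if_pos (by omega), if_pos rfl]
    · have hk : ¬ (N - (i.val + 1) + k.val + 1 = N) := fun h => hik (Fin.ext (by omega))
      rw [if_neg hk, if_neg hik]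
  · intro j _ hj
    simp only [Matrix.of_apply]
    have hij : ¬ (i.val + j.val + 1 = N) := fun h => hj (Fin.ext (by rw [Fin.val_rev]; omega))
    rw [if_neg hij, zero_mul]
  · intro h
    exact absurd (Finset.mem_univ _) h

omit [NumberField L] [IsCMField L] in
/-- `det Φ_N ≠ 0` (from `Φ_N² = 1`). [folklore] -/
theorem splitFormMatrix_det_ne_zero (N : ℕ) :
    (Matrix.of fun i j : Fin N => if i.val + j.val + 1 = N then (1 : L) else 0).det ≠ 0 := by
  intro h0
  have h := congrArg Matrix.det (splitFormMatrix_mul_self L N)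
  rw [Matrix.det_mul, Matrix.det_one, h0, zero_mul] at h
  exact zero_ne_one h

/-- `Φ_N` is hermitian for the CM conjugation: its entries `0, 1` are fixed by `c` and it is symmetric. [folklore] -/
theorem splitFormMatrix_isHermitian (N : ℕ) :
    ((Matrix.of fun i j : Fin N => if i.val + j.val + 1 = N then (1 : L) else 0).map (cmConjRingHom L))ᵀ =
      Matrix.of fun i j : Fin N => if i.val + j.val + 1 = N then (1 : L) else 0 := by
  ext i j
  simp only [Matrix.transpose_apply, Matrix.map_apply, Matrix.of_apply]
  rw [apply_ite (cmConjRingHom L), map_one, map_zero]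
  by_cases h : i.val + j.val + 1 = N
  · rw [if_pos h, if_pos (by omega)]
  · rw [if_neg h, if_neg (by omega)]

/-- **S3 for EVERY `N` from the Siegel-set integrability of the hermitian orbit count.**  If for every `N` the count
`g ↦ #{h ∈ M_N(L) hermitian : (cg)ᵀ h_𝔸 g ∈ B}` is integrable over every thickened Siegel set `Z Ω A_t K` of `GL_N(𝔸_L)` for every compact `B`
(the box count of reduction theory — the content of the S3 plan's counting files), then the quasi-split unitary groups `U(Φ_N)` of ALL ranks carry
automorphic measures: `Φ_N` is hermitian with `det Φ_N ≠ 0` (§3), so ★ `UnitaryGroup.exists_isAutomorphicMeasure_cmDatum_of_orbitCount` (finite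
covolume by orbit-count unfolding + lattice ⇒ unimodular + the covering-set constructor) applies. [cite: Borel1963, §5 Thm. 5.8]
[cite: PlatonovRapinchuk1994, Thm. 4.17] -/
theorem stubS3_all_of_orbitCount
    (hcount : ∀ N : ℕ, ∀ (_ : MeasurableSpace (GL (Fin N) (AdeleRing (𝓞 L) L)))
      (_ : BorelSpace (GL (Fin N) (AdeleRing (𝓞 L) L)))
      (μ : Measure (GL (Fin N) (AdeleRing (𝓞 L) L))) (_ : μ.IsHaarMeasure)
      (B : Set (Matrix (Fin N) (Fin N) (AdeleRing (𝓞 L) L))), IsCompact B →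
      ∀ (Ω : Set (GL (Fin N) (AdeleRing (𝓞 L) L))) (t : ℝ) (Z : Set (GL (Fin N) (AdeleRing (𝓞 L) L))),
        0 < t → IsCompact Ω →
        Ω ⊆ (standardParabolicGL (AdeleRing (𝓞 L) L) (id : Fin N → Fin N) :
          Set (GL (Fin N) (AdeleRing (𝓞 L) L))) →
        IsCompact Z → Z ⊆ Set.range (posRealScalar N L) →
        ∫⁻ g in Z * (Ω * siegelCone N L t *
            (standardMaximalCompactGL N L : Set (GL (Fin N) (AdeleRing (𝓞 L) L)))),
          (({h : Matrix (Fin N) (Fin N) L | (h.map (cmConjRingHom L))ᵀ = h ∧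
              (Godement.conjAct L).act (h.map (algebraMap L (AdeleRing (𝓞 L) L))) g ∈ B}.ncard :
                ℕ) : ℝ≥0∞) ∂μ < ⊤) :
    ∀ N : ℕ, ∃ μ' : Measure (UnitaryGroup.cmDatum L N
        (Matrix.of fun i j : Fin N => if i.val + j.val + 1 = N then (1 : L) else 0)).automorphicQuotient,
      (UnitaryGroup.cmDatum L N
        (Matrix.of fun i j : Fin N => if i.val + j.val + 1 = N then (1 : L) else 0)).IsAutomorphicMeasure μ' :=
  fun N => UnitaryGroup.exists_isAutomorphicMeasure_cmDatum_of_orbitCount (splitFormMatrix_isHermitian L N)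
    (splitFormMatrix_det_ne_zero L N) (hcount N)

/-- **Stub S3 (registered body, ed. 1.4: `∀ N ≤ 3`) from the Siegel-set integrability of the hermitian orbit count** — the conclusion is the
registered body VERBATIM; the antecedent is the counting files' export for `N ≤ 3`. [cite: Borel1963, §5 Thm. 5.8] [cite: PlatonovRapinchuk1994, Thm. 4.17] -/
theorem stubS3_of_orbitCount
    (hcount : ∀ N : ℕ, N ≤ 3 → ∀ (_ : MeasurableSpace (GL (Fin N) (AdeleRing (𝓞 L) L)))
      (_ : BorelSpace (GL (Fin N) (AdeleRing (𝓞 L) L)))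
      (μ : Measure (GL (Fin N) (AdeleRing (𝓞 L) L))) (_ : μ.IsHaarMeasure)
      (B : Set (Matrix (Fin N) (Fin N) (AdeleRing (𝓞 L) L))), IsCompact B →
      ∀ (Ω : Set (GL (Fin N) (AdeleRing (𝓞 L) L))) (t : ℝ) (Z : Set (GL (Fin N) (AdeleRing (𝓞 L) L))),
        0 < t → IsCompact Ω →
        Ω ⊆ (standardParabolicGL (AdeleRing (𝓞 L) L) (id : Fin N → Fin N) :
          Set (GL (Fin N) (AdeleRing (𝓞 L) L))) →
        IsCompact Z → Z ⊆ Set.range (posRealScalar N L) →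
        ∫⁻ g in Z * (Ω * siegelCone N L t *
            (standardMaximalCompactGL N L : Set (GL (Fin N) (AdeleRing (𝓞 L) L)))),
          (({h : Matrix (Fin N) (Fin N) L | (h.map (cmConjRingHom L))ᵀ = h ∧
              (Godement.conjAct L).act (h.map (algebraMap L (AdeleRing (𝓞 L) L))) g ∈ B}.ncard :
                ℕ) : ℝ≥0∞) ∂μ < ⊤) :
    ∀ N : ℕ, N ≤ 3 → ∃ μ' : Measure (UnitaryGroup.cmDatum L N
        (Matrix.of fun i j : Fin N => if i.val + j.val + 1 = N then (1 : L) else 0)).automorphicQuotient,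
      (UnitaryGroup.cmDatum L N
        (Matrix.of fun i j : Fin N => if i.val + j.val + 1 = N then (1 : L) else 0)).IsAutomorphicMeasure μ' :=
  fun N hN => UnitaryGroup.exists_isAutomorphicMeasure_cmDatum_of_orbitCount (splitFormMatrix_isHermitian L N)
    (splitFormMatrix_det_ne_zero L N) (hcount N hN)

/-! ## §4 THE CLOSER: S3 unconditionally (orbit-count unfolding + the counting files) -/

/-- **Automorphic measure on `U(Φ_N)(L⁺)\U(Φ_N)(𝔸_{L⁺})` for EVERY `N`** (the `∀ N` body of S3 in editions ≤ 1.3, now a theorem):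
Borel–Harish-Chandra finiteness for the quasi-split unitary groups of a CM extension, by orbit-count unfolding against the reduction theory
of `GL_N(𝔸_L)` (★ `UnitaryGroup.exists_isAutomorphicMeasure_cmDatum_of_orbitCount`) fed with the Siegel-set integrability of the hermitian
orbit count (★ `lintegral_ncard_hermitianOrbitSet_siegelSet_lt_top`). [cite: Borel1963, §5 Thm. 5.8] [cite: PlatonovRapinchuk1994, Thm. 4.17] -/
theorem stubS3_all :
    ∀ N : ℕ, ∃ μ' : Measure (UnitaryGroup.cmDatum L N
        (Matrix.of fun i j : Fin N => if i.val + j.val + 1 = N then (1 : L) else 0)).automorphicQuotient,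
      (UnitaryGroup.cmDatum L N
        (Matrix.of fun i j : Fin N => if i.val + j.val + 1 = N then (1 : L) else 0)).IsAutomorphicMeasure μ' :=
  stubS3_all_of_orbitCount L fun N _ _ μ _ _ hB _ _ _ ht hΩc hΩB hZc hZ =>
    lintegral_ncard_hermitianOrbitSet_siegelSet_lt_top L N μ hB hΩc hΩB ht hZc hZ

/-- **STUB S3 CLOSED — `stub_T1c_splitFormAutomorphicMeasure`**: TYPE = the body of `StubT1cSplitFormAutomorphicMeasure L` (registered ed. 1.4∕1.5,
`∀ N ≤ 3, ∃ μ', IsAutomorphicMeasure μ'` on `U(Φ_N)(L⁺)\U(Φ_N)(𝔸_{L⁺})`) VERBATIM; fold for the registrar: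
`theorem stub_T1c_splitFormAutomorphicMeasure : StubT1cSplitFormAutomorphicMeasure L := F0P3aStubS3SplitFormMeasure.stubS3_holds L`.
[cite: Borel1963, §5 Thm. 5.8] [cite: PlatonovRapinchuk1994, Thm. 4.17] -/
theorem stubS3_holds :
    ∀ N : ℕ, N ≤ 3 → ∃ μ' : Measure (UnitaryGroup.cmDatum L N
        (Matrix.of fun i j : Fin N => if i.val + j.val + 1 = N then (1 : L) else 0)).automorphicQuotient,
      (UnitaryGroup.cmDatum L N
        (Matrix.of fun i j : Fin N => if i.val + j.val + 1 = N then (1 : L) else 0)).IsAutomorphicMeasure μ' :=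
  fun N _ => stubS3_all L N

end Summit.HodgeConjecture.HodgeConjecture.Cruxes.H413.F0P3aStubS3SplitFormMeasure

end
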